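import Mathlib
import Summits.BirchSwinnertonDyer.BirchSwinnertonDyer.Theorems.ManinLocalTwoThreeOddDegreeCuspHalfUnit
import Summits.BirchSwinnertonDyer.BirchSwinnertonDyer.Theorems.ManinLocalTwoThreeOddDegreeCuspQuarterUnit
import Summits.BirchSwinnertonDyer.BirchSwinnertonDyer.Theorems.ManinLocalTwoThreeThreeDvdDegreeOrCuspOrderThree
import Summits.BirchSwinnertonDyer.BirchSwinnertonDyer.Theorems.ManinLocalTwoThreeOddDegreeAnalyticRankZero
import HarnessLib

/-!
# `N = 4p`: modular degree prime to `3` forces `L(W,1) ≠ 0`; degree prime to `6` pins `L(W,1)/Ω⁺_f` 6-adically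

Summit `BirchSwinnertonDyer`, sub-problem `BirchSwinnertonDyer`, route `ManinLocalTwoThree`; width seat `bsd-line-manin23-p2`
(gen 9), `--supports` the crux C2 `ManinOddAtFour` (stmt-BirchSwinnertonDyer-22967).  The 3-adic sibling of the odd-degree
package: at `N = 4p` (`p` an odd prime; every curve, every datum) the tree's `ThreeDvdModularDegreeOfCuspImageZero`
(`φ_D([1/p]) = O ⟹ 3 ∣ deg φ_D`, Literature-level theorem of the cell) gives `3 ∤ deg ⟹ {∞,1/p}_f ∉ Λ_f`, and the hexagon
(`{∞,0} − {∞,¼} − {∞,1/p} ∈ Λ_f`, `2{∞,¼} ∈ Λ_f`, `3{∞,1/p} ∈ Λ_f`) turns this into `2·{∞,0}_f ∉ Λ_f`; hence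
`L(W,1) ≠ 0`, analytic rank `0`, and `2·[0]⁺_f ∉ ℤ`.  Combined with the odd-degree files: for a lattice-optimal datum of
degree PRIME TO 6, `L(W,1)/Ω⁺_f = k/(6·#π₀(W(ℝ)))` with `gcd(k,6) = 1`.

PROVED here (no `sorry`): `cuspInvP_symbol_not_mem_of_not_three_dvd`, `two_mul_cuspZeroSymbol_not_mem_of_not_three_dvd`,
**`modularSymbol_zero_ne_zero_of_not_three_dvd`**, **`entireLFunction_one_ne_zero_of_not_three_dvd`**,
**`analyticRank_eq_zero_of_not_three_dvd`**, `not_exists_two_mul_ratPlusSymbol_zero_eq_int_of_not_three_dvd`,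
**`six_mul_ratPlusSymbol_zero_coprime_of_coprime_six`** (`Δ < 0`), **`twelve_mul_ratPlusSymbol_zero_coprime_of_coprime_six`**
(`Δ > 0`).  BSD is not proved by this; Manin's conjecture is not proved by this.
-/

set_option autoImplicit false
set_option linter.dupNamespace false

noncomputable section

open scoped MatrixGroups ModularForm
open CongruenceSubgroup
open Literature.NumberTheory.EllipticCurves Literature.NumberTheory.EllipticCurves.ModularForms

namespace Summit.BirchSwinnertonDyer.BirchSwinnertonDyer.Theorems.ManinLocalTwoThree

/-- **`3 ∤ deg φ_D` at `N = 4p` ⟹ `{∞,1/p}_f ∉ Λ_f`** (else `φ_D([1/p]) = O`, which forces `3 ∣ deg`). -/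
theorem cuspInvP_symbol_not_mem_of_not_three_dvd {W : WeierstrassCurve ℚ} [W.IsElliptic] {p : ℕ} [NeZero (4 * p)]
    (hp : p.Prime) (hp2 : p ≠ 2) (D : ModularParametrizationData W (4 * p)) (h3 : ¬ 3 ∣ D.deg) :
    modularSymbol D.f (1 / p : ℚ) ∉ periodLattice D.f := fun hy =>
  h3 (threeDvdModularDegreeOfCuspImageZero_holds W (hp.odd_of_ne_two hp2) D
    ((D.uniformize_eq_zero_iff _).mpr (D.smul_periodLattice_le _ hy)))

/-- **`3 ∤ deg φ_D` at `N = 4p` ⟹ `2·{∞,0}_f ∉ Λ_f`** (hexagon: `2{∞,0} ≡ 2{∞,1/p}` and `3{∞,1/p} ∈ Λ_f`). -/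
theorem two_mul_cuspZeroSymbol_not_mem_of_not_three_dvd {W : WeierstrassCurve ℚ} [W.IsElliptic] {p : ℕ}
    [NeZero (4 * p)] (hp : p.Prime) (hp2 : p ≠ 2) (D : ModularParametrizationData W (4 * p)) (h3 : ¬ 3 ∣ D.deg) :
    (2 : ℂ) * modularSymbol D.f 0 ∉ periodLattice D.f := by
  intro h2x
  obtain ⟨h2q, h3y, hhex, -, -⟩ := fourPCuspHexagon_holds W D p hp hp2 rfl
  apply cuspInvP_symbol_not_mem_of_not_three_dvd hp hp2 D h3
  have h2y : (2 : ℂ) * modularSymbol D.f (1 / p : ℚ) ∈ periodLattice D.f := by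
    have := (periodLattice D.f).sub_mem
      ((periodLattice D.f).sub_mem h2x ((periodLattice D.f).nsmul_mem hhex 2)) h2q
    convert this using 1
    simp only [nsmul_eq_mul]
    push_cast
    ring
  have := (periodLattice D.f).sub_mem h3y h2y
  convert this using 1
  ring

/-- **`3 ∤ deg φ_D` at `N = 4p` ⟹ `{∞,0}_f ≠ 0`.** -/
theorem modularSymbol_zero_ne_zero_of_not_three_dvd {W : WeierstrassCurve ℚ} [W.IsElliptic] {p : ℕ} [NeZero (4 * p)]
    (hp : p.Prime) (hp2 : p ≠ 2) (D : ModularParametrizationData W (4 * p)) (h3 : ¬ 3 ∣ D.deg) :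
    modularSymbol D.f 0 ≠ 0 := fun h0 =>
  two_mul_cuspZeroSymbol_not_mem_of_not_three_dvd hp hp2 D h3 (by rw [h0, mul_zero]; exact (periodLattice D.f).zero_mem)

/-- **`3 ∤ deg φ_D` at `N = 4p` ⟹ `L(W,1) ≠ 0`** (every curve, every datum). -/
theorem entireLFunction_one_ne_zero_of_not_three_dvd {W : WeierstrassCurve ℚ} [W.IsElliptic] {p : ℕ} [NeZero (4 * p)]
    (hp : p.Prime) (hp2 : p ≠ 2) (D : ModularParametrizationData W (4 * p)) (h3 : ¬ 3 ∣ D.deg) :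
    W.entireLFunction 1 ≠ 0 := by
  rw [← D.isNewformOf.modularSymbol_zero_eq_entireLFunction_one]
  exact modularSymbol_zero_ne_zero_of_not_three_dvd hp hp2 D h3

/-- **`3 ∤ deg φ_D` at `N = 4p` ⟹ analytic rank `0`** (every curve, every datum). -/
theorem analyticRank_eq_zero_of_not_three_dvd {W : WeierstrassCurve ℚ} [W.IsElliptic] {p : ℕ} [NeZero (4 * p)]
    (hp : p.Prime) (hp2 : p ≠ 2) (D : ModularParametrizationData W (4 * p)) (h3 : ¬ 3 ∣ D.deg) :
    W.analyticRank = 0 :=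
  (WeierstrassCurve.analyticRank_eq_zero_iff_holds (W := W) D.isNewformOf.hasEntireLFunction).mpr
    (entireLFunction_one_ne_zero_of_not_three_dvd hp hp2 D h3)

/-- **`3 ∤ deg φ_D` at `N = 4p` ⟹ `2·L(W,1)/Ω⁺_f ∉ ℤ`** (`Ω⁺_f ∈ Λ_f`). -/
theorem not_exists_two_mul_ratPlusSymbol_zero_eq_int_of_not_three_dvd {W : WeierstrassCurve ℚ} [W.IsElliptic]
    {p : ℕ} [NeZero (4 * p)] (hp : p.Prime) (hp2 : p ≠ 2) (D : ModularParametrizationData W (4 * p))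
    (h3 : ¬ 3 ∣ D.deg) : ¬ ∃ j : ℤ, 2 * ratPlusSymbol D.f 0 = j := by
  rintro ⟨j, hj⟩
  apply two_mul_cuspZeroSymbol_not_mem_of_not_three_dvd hp hp2 D h3
  have hj' : (((2 * ratPlusSymbol D.f 0 : ℚ) : ℝ) : ℂ) = (((j : ℚ) : ℝ) : ℂ) := by rw [hj]
  convert (periodLattice D.f).zsmul_mem (ofReal_plusPeriod_mem_periodLattice D) j using 1
  rw [modularSymbol_zero_eq_ratPlusSymbol_mul_plusPeriod D, zsmul_eq_mul]
  push_cast at hj' ⊢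
  rw [← mul_assoc, hj']

/-- **Degree prime to `6`, `Δ_W < 0`, lattice-optimal, `N = 4p` ⟹ `6·L(W,1)/Ω⁺_f = k` with `gcd(k, 6) = 1`.** -/
theorem six_mul_ratPlusSymbol_zero_coprime_of_coprime_six {W : WeierstrassCurve ℚ} [W.IsElliptic] {p : ℕ}
    [NeZero (4 * p)] (hp : p.Prime) (hp2 : p ≠ 2) (D : ModularParametrizationData W (4 * p)) (hΔ : W.Δ < 0)
    (hopt : ∀ z ∈ D.L.lattice, ∃ w ∈ periodLattice D.f, z = D.c * w) (hodd : Odd D.deg) (h3 : ¬ 3 ∣ D.deg) :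
    ∃ k : ℤ, Odd k ∧ ¬ (3 : ℤ) ∣ k ∧ 6 * ratPlusSymbol D.f 0 = k := by
  obtain ⟨k, hk, hk6⟩ := six_mul_ratPlusSymbol_zero_odd_of_odd_deg hp hp2 D hΔ hopt hodd
  refine ⟨k, hk, fun ⟨j, hj⟩ =>
    not_exists_two_mul_ratPlusSymbol_zero_eq_int_of_not_three_dvd hp hp2 D h3 ⟨j, ?_⟩, hk6⟩
  have : (6 : ℚ) * ratPlusSymbol D.f 0 = 3 * (j : ℚ) := by rw [hk6, hj]; push_cast; ring
  linarith

/-- **Degree prime to `6`, `Δ_W > 0`, lattice-optimal, `N = 4p` ⟹ `12·L(W,1)/Ω⁺_f = k` with `gcd(k, 6) = 1`**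
(`3 ∣ k` would give `c·2{∞,0}_f = ±(k/3)·Ω₀ ∈ Λ_W = c·Λ_f`). -/
theorem twelve_mul_ratPlusSymbol_zero_coprime_of_coprime_six {W : WeierstrassCurve ℚ} [W.IsElliptic] {p : ℕ}
    [NeZero (4 * p)] (hp : p.Prime) (hp2 : p ≠ 2) (D : ModularParametrizationData W (4 * p)) (hΔ : 0 < W.Δ)
    (hopt : ∀ z ∈ D.L.lattice, ∃ w ∈ periodLattice D.f, z = D.c * w) (hodd : Odd D.deg) (h3 : ¬ 3 ∣ D.deg) :
    ∃ k : ℤ, Odd k ∧ ¬ (3 : ℤ) ∣ k ∧ 12 * ratPlusSymbol D.f 0 = k := by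
  obtain ⟨k, hk, hk12⟩ := twelve_mul_ratPlusSymbol_zero_odd_of_odd_deg_of_Δ_pos hp hp2 D hΔ hopt hodd
  refine ⟨k, hk, ?_, hk12⟩
  rintro ⟨j, rfl⟩
  have hj : 4 * ratPlusSymbol D.f 0 = j := by push_cast at hk12; linarith
  apply two_mul_cuspZeroSymbol_not_mem_of_not_three_dvd hp hp2 D h3
  have hc : (D.c : ℝ) ≠ 0 := Int.cast_ne_zero.mpr D.maninConstant_ne_zero_holds
  have hΩ₀ : (((D.L.minRealPeriod : ℝ)) : ℂ) ∈ D.L.lattice := D.isReal_neronLattice.minRealPeriod_mem_lattice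
  have h2Ω₀ := minRealPeriod_eq_of_Δ_pos D hΔ hopt
  obtain ⟨s, -, hsc⟩ : ∃ s : ℤ, (s = 1 ∨ s = -1) ∧ (D.c : ℝ) = s * |(D.c : ℝ)| := by
    rcases lt_or_gt_of_ne hc with hneg | hpos
    · exact ⟨-1, Or.inr rfl, by rw [abs_of_neg hneg]; push_cast; ring⟩
    · exact ⟨1, Or.inl rfl, by rw [abs_of_pos hpos]; push_cast; ring⟩
  have hmem : (D.c : ℂ) * ((2 : ℂ) * modularSymbol D.f 0) ∈ D.L.lattice := by
    have hz := D.L.lattice.smul_mem (s * j : ℤ) hΩ₀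
    convert hz using 1
    rw [modularSymbol_zero_eq_ratPlusSymbol_mul_plusPeriod D, zsmul_eq_mul]
    have hj' : (((4 * ratPlusSymbol D.f 0 : ℚ) : ℝ) : ℂ) = (((j : ℚ) : ℝ) : ℂ) := by rw [hj]
    have hΩ₀' : ((D.L.minRealPeriod : ℝ) : ℂ) = ((|(D.c : ℝ)| * plusPeriod D.f / 2 : ℝ) : ℂ) := by
      rw [← h2Ω₀]; push_cast; ring
    have hsc' : (((D.c : ℝ)) : ℂ) = (((s : ℝ) * |(D.c : ℝ)| : ℝ) : ℂ) := by rw [← hsc]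
    rw [hΩ₀']
    push_cast at hj' hsc' ⊢
    linear_combination ((s : ℂ) * ((|(D.c : ℝ)| : ℝ) : ℂ) * (plusPeriod D.f : ℂ) / 2) * hj' +
      (2 * ((ratPlusSymbol D.f 0 : ℚ) : ℂ) * (plusPeriod D.f : ℂ)) * hsc'
  obtain ⟨w, hw, hcw⟩ := hopt _ hmem
  have hc' : (D.c : ℂ) ≠ 0 := Int.cast_ne_zero.mpr D.maninConstant_ne_zero_holds
  rwa [mul_left_cancel₀ hc' hcw]

end Summit.BirchSwinnertonDyer.BirchSwinnertonDyer.Theorems.ManinLocalTwoThree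

end
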